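import Literature.NumberTheory.EllipticCurves.RealLatticeRealLocusProofs
import HarnessLib

/-!
# Crux C1 `MainConjectureTransportAlignedAtTwo` (stmt-BirchSwinnertonDyer-22296), line `birth`, plan «deltapos-galois» step (B1):
# AN ODD-DEGREE REAL ISOGENY PRESERVES THE IMAGINARY HALF-PERIOD CLASS (lead att-p1 g10; `--supports 22296`)

THEOREMS ONLY (no `def`, no `sorry`, no named fact). BSD is not proved by this; C1 is not closed by this.

Context (`Cruxes/MainConjectureTransportAlignedAtTwo/Lines/birth-deltapos-galois-plan.md`, file (B1), route (a) of input T4). The point `T* = u(w)`,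
`w = iΩ₀'/2` the imaginary half-period of a real lattice `Λ` (`Ω₀'` = least positive real period of `iΛ`; tree: `IsReal.two_mul_halfPeriodI_mem`), is the
`2`-torsion point of least abscissa when `Δ > 0` (`…AlignedTransportAtTwoHalfPeriodOrdering`, p663962). Along a real isogeny `z ↦ αz : ℂ/Λ → ℂ/Λ'`
(`α ∈ ℝ`, `αΛ ⊆ Λ'`) of ODD degree `m` (dual relation `mΛ' ⊆ αΛ`, as produced by the tree's `Isogeny.exists_real_mul_lattice_le_of_isNeronLatticeOf` and
`…RhombicOfNegDisc.exists_isogeny_odd_degree_of_ratTwoTorsionCard_eq_one`) the class of `w` goes to the class of `w'`: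
**`real_mul_halfPeriodI_sub_halfPeriodI_mem`**: `α·w − w' ∈ Λ'`. No sign condition on the discriminants is needed.
Proof: `2αw ∈ Λ' ∩ iℝ = ℤ·2w'`, so `αw = j·w'`; if `j` were even, `αw ∈ Λ'`, and from `m·2w' = α z`, `z ∈ Λ ∩ iℝ = ℤ·2w`, we get `m w' = kαw ∈ Λ'`, whence
(`m` odd, `2w' ∈ Λ'`) `w' ∈ Λ'` — contradiction.

References: Silverman AEC VI.4.1 (analytic isogenies), ATAEC V.2; Cremona 1997 §2.8; Lawden 1989 §6.11.
-/

noncomputable section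

-- justification: the `Summit.BirchSwinnertonDyer.BirchSwinnertonDyer.…` path repeats a component (route-file convention)
set_option linter.dupNamespace false
set_option autoImplicit false

open scoped ComplexConjugate
open Complex Set PeriodPair

namespace Summit.BirchSwinnertonDyer.BirchSwinnertonDyer.Theorems.AlignedTransportAtTwoDeltaPosOddIsogeny

variable {L L' : PeriodPair}

/-- **Purely imaginary lattice vectors are integer multiples of `2w = iΩ₀'`** (`Ω₀'` the least positive real period of the real lattice `iΛ`). [folklore] -/
theorem exists_eq_int_mul_two_halfPeriodI_of_re_eq_zero (h : L.IsReal) {z : ℂ} (hz : z ∈ L.lattice) (hre : z.re = 0) :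
    ∃ k : ℤ, z = (k : ℂ) * (2 * (I * ((((L.mulLeft I I_ne_zero).minRealPeriod / 2 : ℝ)) : ℂ))) := by
  have hzeq : z = I * ((z.im : ℝ) : ℂ) := by
    apply Complex.ext <;> simp [hre]
  have hz' : ((z.im : ℝ) : ℂ) ∈ (L.mulLeft I I_ne_zero).lattice := by
    rw [mem_mulLeft_lattice, Complex.inv_I]
    have := neg_mem hz
    rw [hzeq] at this
    convert this using 1
    ring
  obtain ⟨k, hk⟩ := h.mulLeft_I.exists_eq_int_mul hz'
  refine ⟨k, ?_⟩
  rw [hzeq, hk]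
  push_cast
  ring

/-- **An odd-degree real isogeny preserves the imaginary half-period class.** `Λ, Λ'` real lattices, `α ∈ ℝ` with `αΛ ⊆ Λ'` and `mΛ' ⊆ αΛ` for an ODD
integer `m` (the degree); `w = iΩ₀'(Λ)/2`, `w' = iΩ₀'(Λ')/2` the imaginary half-periods. Then `α·w − w' ∈ Λ'`: the induced map on `2`-torsion sends the class of
`w` to the class of `w'`. [cite: SilvermanAEC2009, VI.4.1] [cite: CremonaAlgorithms1997, §2.8] -/
theorem real_mul_halfPeriodI_sub_halfPeriodI_mem (h : L.IsReal) (h' : L'.IsReal) {α : ℝ}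
    (hα : ∀ z ∈ L.lattice, (α : ℂ) * z ∈ L'.lattice) {m : ℤ} (hm : Odd m)
    (hm' : ∀ z' ∈ L'.lattice, ∃ z ∈ L.lattice, (m : ℂ) * z' = (α : ℂ) * z) :
    (α : ℂ) * (I * ((((L.mulLeft I I_ne_zero).minRealPeriod / 2 : ℝ)) : ℂ)) -
      I * ((((L'.mulLeft I I_ne_zero).minRealPeriod / 2 : ℝ)) : ℂ) ∈ L'.lattice := by
  obtain ⟨h2w, -, -⟩ := h.two_mul_halfPeriodI_mem
  obtain ⟨h2w', hw'n, -⟩ := h'.two_mul_halfPeriodI_mem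
  set w : ℂ := I * ((((L.mulLeft I I_ne_zero).minRealPeriod / 2 : ℝ)) : ℂ) with hw
  set w' : ℂ := I * ((((L'.mulLeft I I_ne_zero).minRealPeriod / 2 : ℝ)) : ℂ) with hw'
  -- `2αw ∈ Λ'` is purely imaginary, hence `= j·(2w')`, so `αw = j·w'`
  have h2αw : (α : ℂ) * (2 * w) ∈ L'.lattice := hα _ h2w
  have hre : ((α : ℂ) * (2 * w)).re = 0 := by simp [hw]
  obtain ⟨j, hj⟩ := exists_eq_int_mul_two_halfPeriodI_of_re_eq_zero h' h2αw hre
  have hαw : (α : ℂ) * w = (j : ℂ) * w' := by linear_combination hj / 2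
  -- `j` is odd
  have hjodd : Odd j := by
    by_contra hjev
    rw [Int.not_odd_iff_even] at hjev
    obtain ⟨j', rfl⟩ := hjev
    -- then `αw ∈ Λ'`
    have hαwmem : (α : ℂ) * w ∈ L'.lattice := by
      rw [hαw, show ((j' + j' : ℤ) : ℂ) * w' = (j' : ℂ) * (2 * w') by push_cast; ring]
      have := L'.lattice.smul_mem j' h2w'
      rwa [zsmul_eq_mul] at this
    -- `m·(2w') = α z` with `z ∈ Λ` purely imaginary, `z = k·(2w)`
    obtain ⟨z, hz, hmz⟩ := hm' _ h2w'
    have hα0 : (α : ℂ) ≠ 0 := by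
      intro hα0
      rw [hα0, zero_mul] at hmz
      have hm0' : m ≠ 0 := by
        rintro rfl
        exact (Int.not_odd_iff_even.mpr (Even.zero : Even (0 : ℤ))) hm
      have hm0 : (m : ℂ) ≠ 0 := by exact_mod_cast hm0'
      have : (2 : ℂ) * w' = 0 := by
        rcases mul_eq_zero.mp hmz with h0 | h0
        · exact absurd h0 hm0
        · exact h0
      apply hw'n
      have hw0 : w' = 0 := by
        rcases mul_eq_zero.mp this with h0 | h0
        · norm_num at h0
        · exact h0
      rw [hw0]; exact zero_mem _
    have hzre : z.re = 0 := by
      have hre2 : ((m : ℂ) * (2 * w')).re = 0 := by simp [hw']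
      rw [hmz] at hre2
      simpa [hα0, Complex.ofReal_ne_zero.mp hα0] using hre2
    obtain ⟨k, hk⟩ := exists_eq_int_mul_two_halfPeriodI_of_re_eq_zero h hz hzre
    -- `m w' = k α w ∈ Λ'`
    have hmw' : (m : ℂ) * w' = (k : ℂ) * ((α : ℂ) * w) := by
      linear_combination hmz / 2 + (α : ℂ) * hk / 2
    have hmw'mem : (m : ℂ) * w' ∈ L'.lattice := by
      rw [hmw']
      have := L'.lattice.smul_mem k hαwmem
      rwa [zsmul_eq_mul] at this
    -- `m` odd and `2w' ∈ Λ'` give `w' ∈ Λ'`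
    obtain ⟨m', rfl⟩ := hm
    apply hw'n
    have : w' = ((2 * m' + 1 : ℤ) : ℂ) * w' - (m' : ℂ) * (2 * w') := by push_cast; ring
    rw [this]
    refine sub_mem hmw'mem ?_
    have := L'.lattice.smul_mem m' h2w'
    rwa [zsmul_eq_mul] at this
  -- conclude: `αw − w' = ((j−1)/2)·(2w')`
  obtain ⟨j', rfl⟩ := hjodd
  have : (α : ℂ) * w - w' = (j' : ℂ) * (2 * w') := by
    rw [hαw]; push_cast; ring
  rw [this]
  have := L'.lattice.smul_mem j' h2w'
  rwa [zsmul_eq_mul] at this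

end Summit.BirchSwinnertonDyer.BirchSwinnertonDyer.Theorems.AlignedTransportAtTwoDeltaPosOddIsogeny

end
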